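import Summits.HodgeConjecture.HodgeConjecture.Theses.HeckePrymWeil
import Summits.HodgeConjecture.HodgeConjecture.Theorems.HeckePrymWeilHodgeWeilOfSemiregularCleanLci
import Summits.HodgeConjecture.HodgeConjecture.Theorems.HeckePrymWeilHeckePrymAnchorsOfDeligneWeilFamily
import Literature.AlgebraicGeometry.HodgeTheory.WeilFamilyKAction
import Literature.AlgebraicGeometry.HodgeTheory.WeilFamilyBalanced
import Literature.AlgebraicGeometry.HodgeTheory.BlochSemiregularSpread
import HarnessLib

/-!
# `WeilSixfoldsSqrtMinus7` (stmt-HodgeConjecture-1260) ⟸ `DeligneWeilFamily` ∧ S⁺(7,3) ∧ `BlochSemiregularSpread 6 3`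
# — the reduction theorem of line `semiregular-clean-lci-six`, by name (sorry-free)

Route `HeckePrymWeil` (sub-problem `HodgeConjecture`); line lead c12 of crux `WeilSixfoldsSqrtMinus7`
(stmt-HodgeConjecture-1260), 2026-08-17.  The crux-strategist's line
`Cruxes/WeilSixfoldsSqrtMinus7/Lines/semiregular_clean_lci_six.lean` (registered skeleton sha 701ffe1f) reduces the
crux — the Hodge conjecture for the `ℚ(√-7)` Weil classes of EVERY complex abelian sixfold — to three inputs:
(1) Deligne's polarized Weil family through `(A, φ, c)` with its tensor anchor = the route item `DeligneWeilFamily`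
(stmt-HodgeConjecture-16866, OPEN, Lean-XL); (2) **S⁺(7,3)** = the line's hardest stub `stub_semiregularCleanLciSix`:
on every tensor-type `√-7`-sixfold `(Y, Ψ)`, for every projective embedding with `K`-symmetric hyperplane class
(`Ψ^*h = 7h`) and every non-zero rational `(3,3)` class `x₀` of the strong Weil plane, an INTEGRAL closed lci
`Z ↪ Y` of codimension `3`, BLOCH-SEMIREGULAR, carries `α•x₀ + e^*θ` (`α ≠ 0`) — OPEN (a Bloch 1972 Remark
(7.5)-type existence problem; the lead's dossier in the crux directory empties its sub-torus designs, cf.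
`HeckePrymWeilWeilSixfoldsSqrtMinus7SubtorusDesignBound.lean`); (3) Bloch's semiregularity theorem, class level,
at `(n,p) = (6,3)` = the named fact `BlochSemiregularSpread 6 3` (Buchweitz–Flenner 2003 Thm. 5.2 at `I = {p}`;
TRUE in print, unformalised).  The fourth input of the skeleton (Charles–Schnell 11.3.11) is a theorem of the tree.

This file LANDS that reduction as ONE theorem whose conclusion is the route decl BY NAME,
`weilSixfoldsSqrtMinus7_of_semiregularCleanLci : DeligneWeilFamily → S⁺(7,3) → BlochSemiregularSpread 6 3 →
WeilSixfoldsSqrtMinus7` (registered sub-goal of the item), as the `(p,k) = (7,3)` instance of the sibling lead's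
GENERAL composition `hodgeWeil_of_semiregularCleanLci_of_globalAction` (crux 1261, line
`semiregular-clean-lci-anchor`, `HeckePrymWeilHodgeWeilOfSemiregularCleanLci.lean`, landed 2026-08-17 02:41Z):
the item is turned into Deligne's global-action package by the landed `kAction_of_deligneWeilFamily` and
`deligne1982_weilFamily_globalAction_of_kAction`, and the only work left is cast bookkeeping between the crux's
literals (`6`, `(7 : ℤ)`, `√7`) and the general theorem's (`2*3`, `((7 : ℕ) : ℤ)`, `√(7 : ℕ)`).
CONDITIONAL on its three hypotheses by design (two open, one true in print); no `sorry`, no definition.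
-/

noncomputable section

-- every declaration of this problem lives in `Summit.HodgeConjecture.HodgeConjecture.…` (summit = sub-problem)
set_option linter.dupNamespace false

open CategoryTheory AlgebraicGeometry Limits
open Literature.AlgebraicGeometry Literature.AlgebraicGeometry.Motives Literature.AlgebraicGeometry.HodgeTheory
open Summit.HodgeConjecture.HodgeConjecture.Theorems.HeckePrymWeilLine

namespace Summit.HodgeConjecture.HodgeConjecture.Theorems.HeckePrymWeilLine.SemiregularCleanLciSix

/-- **MAIN THEOREM — the reduction of the crux `WeilSixfoldsSqrtMinus7`, by name.**  Deligne's Weil family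
through the given sixfold (route item `DeligneWeilFamily`, stmt-16866), the existence statement **S⁺(7,3)** (the
line's `stub_semiregularCleanLciSix`, verbatim: a clean, charged, Bloch-semiregular INTEGRAL lci 3-fold on every
tensor-type `√-7` sixfold, for every `K`-symmetric projective embedding and every non-zero rational `(3,3)` Weil
class) and Bloch's semiregularity theorem at `(6,3)` (`BlochSemiregularSpread 6 3`) together imply
`HeckePrymWeil.WeilSixfoldsSqrtMinus7`.  Proof: the `(p,k) = (7,3)` instance of
`hodgeWeil_of_semiregularCleanLci_of_globalAction`, after `kAction_of_deligneWeilFamily` /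
`deligne1982_weilFamily_globalAction_of_kAction` and cast bookkeeping.  CONDITIONAL on the three hypotheses.
[cite: Bloch1972Semiregularity, Thm. (7.4), Remark (7.5)] [cite: BuchweitzFlenner2003, Thm. 5.2]
[cite: Deligne1982HodgeCycles, proof of Thm. 4.8, Lemma 4.5] [cite: CharlesSchnell2014Notes, Prop. 11.3.11] -/
theorem weilSixfoldsSqrtMinus7_of_semiregularCleanLci :
    Summit.HodgeConjecture.HodgeConjecture.Theses.HeckePrymWeil.DeligneWeilFamily →
    (∀ (Y : AbelianVariety ℂ) (Ψ : Y ⟶ Y), Y.dim = 2 * 3 → Ψ ≫ Ψ = -((7 : ℤ) • 𝟙 Y) →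
        (∃ (A₁ : AbelianVariety ℂ) (f₁ : Y ⟶ A₁.prod A₁) (g₁ : A₁.prod A₁ ⟶ Y) (m : ℕ),
            A₁.dim = 3 ∧ 0 < m ∧ f₁ ≫ g₁ = m • 𝟙 Y ∧ Flat f₁.hom.hom.hom.left ∧
            g₁ ≫ Ψ = AbelianVariety.prodLift (AbelianVariety.snd A₁ A₁ ≫ (-((7 : ℤ) • 𝟙 A₁)))
              (AbelianVariety.fst A₁ A₁) ≫ g₁) →
        ∀ (e : ProjectiveEmbedding Y.X) (a : complexBetti (projectiveSpace e.n ℂ) 2),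
          IsRationalClass a → a ≠ 0 →
          complexBetti.map Ψ.hom.hom.hom 2 (complexBetti.map e.ι 2 a) = (7 : ℂ) • complexBetti.map e.ι 2 a →
        ∀ (x₀ : complexBetti Y.X (2 * 3)),
          x₀ ∈ weilClassesOf Y Ψ 3 7 → x₀ ≠ 0 → IsRationalClass x₀ →
          IsOfHodgeType (2 * 3) Y.X (2 * 3) 3 3 x₀ →
          ∃ (Z : Scheme.{0}) (i : Z ⟶ Y.X.left) (θ : complexBetti (projectiveSpace e.n ℂ) (2 * 3)) (α : ℚ),
            IsClosedImmersion i ∧ IsRegularImmersionOfCodim i 3 ∧ AlgebraicGeometry.IsIntegral Z ∧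
            (∀ z ∈ Set.range i.base, ((3 : ℕ) : ℕ∞) ≤ Order.coheight z) ∧
            IsBlochSemiregular i 6 3 ∧ IsRationalClass θ ∧ α ≠ 0 ∧
            ((α : ℂ) • x₀ + complexBetti.map e.ι (2 * 3) θ) ∈
              classesSupportedOn Y.X (Set.range i.base) (2 * 3)) →
    BlochSemiregularSpread 6 3 →
    Summit.HodgeConjecture.HodgeConjecture.Theses.HeckePrymWeil.WeilSixfoldsSqrtMinus7 := by
  intro h₁ h₂ h₃ A φ hA hφ c hrat hH hW
  -- the crux's literals, recast in the general theorem's spelling at `(p,k) = (7,3)`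
  have hA' : A.dim = 2 * 3 := by simpa using hA
  have hφ' : φ ≫ φ = -(((7 : ℕ) : ℤ) • 𝟙 A) := by exact_mod_cast hφ
  have hW' : c ∈ Module.End.eigenspace (complexBetti.map (𝟙 A + φ).hom.hom.hom (2 * 3)).hom
        ((1 + Complex.I * (Real.sqrt ((7 : ℕ) : ℝ) : ℂ)) ^ (2 * 3)) ⊔
      Module.End.eigenspace (complexBetti.map (𝟙 A + φ).hom.hom.hom (2 * 3)).hom
        ((1 - Complex.I * (Real.sqrt ((7 : ℕ) : ℝ) : ℂ)) ^ (2 * 3)) := by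
    exact_mod_cast hW
  have hH' : IsOfHodgeType (2 * 3) A.X (2 * 3) 3 3 c := hH
  -- the supply S⁺(7,3), recast likewise
  have hS : ∀ (Y : AbelianVariety ℂ) (Ψ : Y ⟶ Y), Y.dim = 2 * 3 → Ψ ≫ Ψ = -(((7 : ℕ) : ℤ) • 𝟙 Y) →
      (∃ (A₁ : AbelianVariety ℂ) (f₁ : Y ⟶ A₁.prod A₁) (g₁ : A₁.prod A₁ ⟶ Y) (m : ℕ),
          A₁.dim = 3 ∧ 0 < m ∧ f₁ ≫ g₁ = m • 𝟙 Y ∧ Flat f₁.hom.hom.hom.left ∧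
          g₁ ≫ Ψ = AbelianVariety.prodLift (AbelianVariety.snd A₁ A₁ ≫ (-(((7 : ℕ) : ℤ) • 𝟙 A₁)))
            (AbelianVariety.fst A₁ A₁) ≫ g₁) →
      ∀ (e : ProjectiveEmbedding Y.X) (a : complexBetti (projectiveSpace e.n ℂ) 2),
        IsRationalClass a → a ≠ 0 →
        complexBetti.map Ψ.hom.hom.hom 2 (complexBetti.map e.ι 2 a) =
          ((7 : ℕ) : ℂ) • complexBetti.map e.ι 2 a →
      ∀ (x₀ : complexBetti Y.X (2 * 3)),
        x₀ ∈ weilClassesOf Y Ψ 3 7 → x₀ ≠ 0 → IsRationalClass x₀ →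
        IsOfHodgeType (2 * 3) Y.X (2 * 3) 3 3 x₀ →
        ∃ (Z : Scheme.{0}) (i : Z ⟶ Y.X.left) (θ : complexBetti (projectiveSpace e.n ℂ) (2 * 3)) (α : ℚ),
          IsClosedImmersion i ∧ IsRegularImmersionOfCodim i 3 ∧ AlgebraicGeometry.IsIntegral Z ∧
          (∀ z ∈ Set.range i.base, ((3 : ℕ) : ℕ∞) ≤ Order.coheight z) ∧
          IsBlochSemiregular i (2 * 3) 3 ∧ IsRationalClass θ ∧ α ≠ 0 ∧
          ((α : ℂ) • x₀ + complexBetti.map e.ι (2 * 3) θ) ∈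
            classesSupportedOn Y.X (Set.range i.base) (2 * 3) := by
    intro Y Ψ hY hΨ htensor e a ha ha0 hK x₀ hx₀ hx₀ne hx₀rat hx₀H
    have hΨ' : Ψ ≫ Ψ = -((7 : ℤ) • 𝟙 Y) := by exact_mod_cast hΨ
    have htensor' : ∃ (A₁ : AbelianVariety ℂ) (f₁ : Y ⟶ A₁.prod A₁) (g₁ : A₁.prod A₁ ⟶ Y) (m : ℕ),
        A₁.dim = 3 ∧ 0 < m ∧ f₁ ≫ g₁ = m • 𝟙 Y ∧ Flat f₁.hom.hom.hom.left ∧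
        g₁ ≫ Ψ = AbelianVariety.prodLift (AbelianVariety.snd A₁ A₁ ≫ (-((7 : ℤ) • 𝟙 A₁)))
          (AbelianVariety.fst A₁ A₁) ≫ g₁ := by
      obtain ⟨A₁, f₁, g₁, m, hA₁, hm, hfg, hf, hg₁⟩ := htensor
      exact ⟨A₁, f₁, g₁, m, hA₁, hm, hfg, hf, by exact_mod_cast hg₁⟩
    have hK' : complexBetti.map Ψ.hom.hom.hom 2 (complexBetti.map e.ι 2 a) =
        (7 : ℂ) • complexBetti.map e.ι 2 a := by exact_mod_cast hK
    exact h₂ Y Ψ hY hΨ' htensor' e a ha ha0 hK' x₀ hx₀ hx₀ne hx₀rat hx₀H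
  exact hodgeWeil_of_semiregularCleanLci_of_globalAction
    (deligne1982_weilFamily_globalAction_of_kAction (kAction_of_deligneWeilFamily h₁))
    (p := 7) (by norm_num) (by norm_num) le_rfl (k := 3) (by norm_num) hS h₃ A φ hA' hφ' c hrat hH' hW'

end Summit.HodgeConjecture.HodgeConjecture.Theorems.HeckePrymWeilLine.SemiregularCleanLciSix

end
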